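import Summits.FinalStateConjecture.FinalStateConjecture.Theorems.EIHFluxBalanceInertialRecessionStubRechart3ChartBounds

/-!
# Route EIHFluxBalance — `InertialRecession`, re-charting: injectivity of the clock chart

Helper file for the crux `stmt-FinalStateConjecture-10166`
(`Summit.FinalStateConjecture.FinalStateConjecture.Theses.EIHFluxBalance.InertialRecession`),
line `sublinear-is-free-clean-window-charges`, stub `stub_rechart` (the transfer P2), part G1.

* `spatial_symm_purgedFrame` — the spatial placement `ỹ ↦ (M ỹ)~` of the purged frame has the
  explicit left inverse `x ↦ (Λ⁻¹(0, x))~`; hence `‖ỹ‖ ≤ ‖Λ⁻¹‖ ‖(M ỹ)~‖` and injectivity;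
* `injOn_honestChart` — the honest chart is injective on every late region `{s₀ ≤ y⁰, ‖ỹ‖ ≤ K}`
  on which the tilt varies slowly (`‖ℓ'‖ K ≤ 1/2` after lab time `T₀ s₀`): equal images have equal
  lab times, then equal spatial parts, then equal model times (`s ↦ T₀ s + ℓ(T₀ s)ỹ` is strictly
  increasing);
* `injective_of_norm_sub_mul_lt_one`, `injective_fderiv_honestChart` — the differential of the
  honest chart is injective wherever it is closer to the frozen frame than `1/‖frame⁻¹‖`. [folklore]
-/

noncomputable section

set_option linter.dupNamespace false

open Set Filter Function Metric Topology
open scoped ContDiff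
open Literature.Geometry.Lorentzian

namespace Summit.FinalStateConjecture.FinalStateConjecture.Theorems.SublinearIsFree.Rechart

/-! ### The spatial placement of the purged frame is invertible -/

/-- **Left inverse of the purged placement**: `(Λ⁻¹ (M z))~ = z`. [folklore] -/
theorem spatial_symm_purgedFrame (Λ : lorentzGroup) (z : E3) :
    E4.spatial ((Λ : E4 ≃L[ℝ] E4).symm (purgedFrame Λ z)) = z := by
  have h := purgedFrame_eq_apply_purge Λ (E4.spaceEmbed z)
  rw [E4.spaceEmbed_apply, E4.spatial_ofTimeSpace] at h
  rw [h, ContinuousLinearEquiv.symm_apply_apply, map_sub, map_smul, E4.spatial_ofTimeSpace]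
  have : E4.spatial (E4.basisVector 0) = 0 := by ext k; fin_cases k <;> simp
  rw [this, smul_zero, sub_zero]

/-- The purged placement is purely spatial, so its norm is the norm of its spatial part. [folklore] -/
theorem norm_purgedFrame_apply (Λ : lorentzGroup) (z : E3) :
    ‖purgedFrame Λ z‖ = ‖E4.spatial (purgedFrame Λ z)‖ :=
  norm_eq_spatialNorm_of_apply_zero_eq_zero (purgedFrame_apply_zero Λ z)

/-- **Coercivity of the spatial placement**: `‖z‖ ≤ ‖Λ⁻¹‖ ‖(M z)~‖`. [folklore] -/
theorem norm_le_mul_norm_spatial_purgedFrame (Λ : lorentzGroup) (z : E3) :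
    ‖z‖ ≤ ‖(((Λ : E4 ≃L[ℝ] E4).symm : E4 ≃L[ℝ] E4) : E4 →L[ℝ] E4)‖ * ‖E4.spatial (purgedFrame Λ z)‖ := by
  have h1 : ‖z‖ ≤ ‖(Λ : E4 ≃L[ℝ] E4).symm (purgedFrame Λ z)‖ := by
    conv_lhs => rw [← spatial_symm_purgedFrame Λ z]
    exact (E4.spatial.le_opNorm _).trans
      ((mul_le_mul_of_nonneg_right norm_spatialCLM_le (norm_nonneg _)).trans (by rw [one_mul]))
  refine h1.trans ?_
  rw [← norm_purgedFrame_apply]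
  exact ((Λ : E4 ≃L[ℝ] E4).symm : E4 →L[ℝ] E4).le_opNorm _

/-- The spatial placement is injective. [folklore] -/
theorem injective_spatial_purgedFrame (Λ : lorentzGroup) :
    Injective fun z : E3 ↦ E4.spatial (purgedFrame Λ z) := fun z z' h ↦ by
  have h1 := spatial_symm_purgedFrame Λ z
  have h2 := spatial_symm_purgedFrame Λ z'
  have h3 : purgedFrame Λ z = purgedFrame Λ z' := by
    have e1 : purgedFrame Λ z = E4.spaceEmbed (E4.spatial (purgedFrame Λ z)) := by
      rw [E4.spaceEmbed_apply, ← purgedFrame_apply_zero Λ z]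
      exact (E4.ofTimeSpace_time_spatial _).symm
    have e2 : purgedFrame Λ z' = E4.spaceEmbed (E4.spatial (purgedFrame Λ z')) := by
      rw [E4.spaceEmbed_apply, ← purgedFrame_apply_zero Λ z']
      exact (E4.ofTimeSpace_time_spatial _).symm
    rw [e1, e2]
    exact congrArg _ h
  rw [← h1, ← h2, h3]

/-! ### Injectivity of the honest chart on late bounded regions -/

section Inj

variable (Λ : ℝ → lorentzGroup) (ξ : ℝ → E3) (T₀ : ℝ → ℝ)
  (hΛ : ContDiff ℝ ∞ (fun t ↦ ((Λ t : E4 ≃L[ℝ] E4) : E4 →L[ℝ] E4)))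
  (hT₀ : ContDiff ℝ ∞ T₀) (hclock : ∀ τ, HasDerivAt T₀ (frameVel (Λ (T₀ τ)) 0) τ)
  (hu1 : ∀ t, 1 ≤ frameVel (Λ t) 0)

include hΛ hT₀ hclock hu1 in
/-- **The model-time slice function is strictly increasing**: for fixed `w` with `‖ℓ'(t)‖ ‖w‖ ≤ 1/2`
for all lab times `t ≥ T₀ s₀`, `s ↦ T₀ s + ℓ(T₀ s) w` is strictly increasing on `[s₀, ∞)`. [folklore] -/
theorem strictMonoOn_clockSlice {S s₀ : ℝ} (hS : S ≤ T₀ s₀) {δ K : ℝ} (hδK : δ * K ≤ 1 / 2)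
    (hL' : ∀ s, S ≤ s → ‖deriv (fun t ↦ frameTilt (Λ t)) s‖ ≤ δ) {w : E3} (hw : ‖w‖ ≤ K) :
    StrictMonoOn (fun s ↦ T₀ s + frameTilt (Λ (T₀ s)) w) (Ici s₀) := by
  have hmono : Monotone T₀ :=
    (strictMono_of_deriv_pos fun x ↦ by rw [(hclock x).deriv]; linarith [hu1 (T₀ x)]).monotone
  set L : ℝ → E3 →L[ℝ] ℝ := fun t ↦ frameTilt (Λ t) with hL
  have hLd : Differentiable ℝ L := (contDiff_frameTilt Λ hΛ).differentiable (by simp)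
  have hT₀d : Differentiable ℝ T₀ := hT₀.differentiable (by simp)
  -- derivative of the slice function
  have hder : ∀ s, HasDerivAt (fun s ↦ T₀ s + frameTilt (Λ (T₀ s)) w)
      (frameVel (Λ (T₀ s)) 0 * (1 + deriv L (T₀ s) w)) s := by
    intro s
    have h1 : HasDerivAt (fun s ↦ L (T₀ s)) (frameVel (Λ (T₀ s)) 0 • deriv L (T₀ s)) s := by
      have := ((hLd (T₀ s)).hasDerivAt).scomp s (hclock s)
      exact this
    have h2 : HasDerivAt (fun s ↦ L (T₀ s) w) ((frameVel (Λ (T₀ s)) 0 • deriv L (T₀ s)) w) s :=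
      h1.clm_apply (hasDerivAt_const s w) |>.congr_deriv (by simp)
    have h3 := (hclock s).add h2
    refine h3.congr_deriv ?_
    simp only [FunLike.coe_smul, Pi.smul_apply, smul_eq_mul]
    ring
  refine strictMonoOn_of_deriv_pos (convex_Ici s₀) ?_ fun s hs ↦ ?_
  · exact HasDerivAt.continuousOn fun s _ ↦ hder s
  · rw [interior_Ici] at hs
    rw [(hder s).deriv]
    have hs' : S ≤ T₀ s := hS.trans (hmono (le_of_lt hs))
    have h1 : |deriv L (T₀ s) w| ≤ 1 / 2 := by
      refine (Real.norm_eq_abs _ ▸ (deriv L (T₀ s)).le_opNorm w).trans ?_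
      have h2 := hL' (T₀ s) hs'
      have h3 : ‖deriv L (T₀ s)‖ * ‖w‖ ≤ δ * K :=
        mul_le_mul h2 hw (norm_nonneg _) ((norm_nonneg _).trans h2)
      linarith
    have h4 : 1 / 2 ≤ 1 + deriv L (T₀ s) w := by linarith [neg_abs_le (deriv L (T₀ s) w)]
    have h5 := hu1 (T₀ s)
    positivity

include hΛ hT₀ hclock hu1 in
/-- **The honest chart is injective on late bounded regions.** If `‖ℓ'(t)‖ ≤ δ` for lab times
`t ≥ S`, `S ≤ T₀ s₀` and `δ K ≤ 1/2`, then `ψ` is injective on `{y | s₀ ≤ y⁰, ‖ỹ‖ ≤ K}`.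
[folklore] -/
theorem injOn_honestChart {S s₀ : ℝ} (hS : S ≤ T₀ s₀) {δ K : ℝ} (hδK : δ * K ≤ 1 / 2)
    (hL' : ∀ s, S ≤ s → ‖deriv (fun t ↦ frameTilt (Λ t)) s‖ ≤ δ) :
    InjOn (honestChart Λ ξ T₀) {y : E4 | s₀ ≤ y 0 ∧ ‖E4.spatial y‖ ≤ K} := by
  intro y hy y' hy' h
  -- equal lab times
  have ht : clockMap Λ T₀ y = clockMap Λ T₀ y' := by
    have := congrArg (fun x : E4 ↦ x 0) h
    simpa only [honestChart_apply_zero] using this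
  -- equal spatial parts
  have hsp : E4.spatial y = E4.spatial y' := by
    have h2 := congrArg E4.spatial h
    rw [spatial_honestChart, spatial_honestChart, ht, add_right_inj] at h2
    exact injective_spatial_purgedFrame _ h2
  -- equal model times
  have h0 : y 0 = y' 0 := by
    have hmono := strictMonoOn_clockSlice Λ T₀ hΛ hT₀ hclock hu1 hS hδK hL' hy.2
    have heq : T₀ (y 0) + frameTilt (Λ (T₀ (y 0))) (E4.spatial y) =
        T₀ (y' 0) + frameTilt (Λ (T₀ (y' 0))) (E4.spatial y) := by
      have := ht
      rw [clockMap, clockMap, ← hsp] at this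
      exact this
    exact hmono.injOn hy.1 hy'.1 heq
  rw [← E4.ofTimeSpace_time_spatial y, ← E4.ofTimeSpace_time_spatial y', E4.time_apply, E4.time_apply,
    h0, hsp]

end Inj

/-! ### Injectivity of the differential -/

/-- An operator within `1/‖L⁻¹‖` of an invertible operator `L` is injective. [folklore] -/
theorem injective_of_norm_sub_mul_lt_one (L : E4 ≃L[ℝ] E4) (A : E4 →L[ℝ] E4)
    (h : ‖A - (L : E4 →L[ℝ] E4)‖ * ‖((L.symm : E4 ≃L[ℝ] E4) : E4 →L[ℝ] E4)‖ < 1) : Injective A := by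
  refine (injective_iff_map_eq_zero A).mpr fun v hv ↦ ?_
  by_contra hne
  have hvpos : 0 < ‖v‖ := norm_pos_iff.mpr hne
  have h1 : ‖v‖ ≤ ‖((L.symm : E4 ≃L[ℝ] E4) : E4 →L[ℝ] E4)‖ * ‖L v‖ := by
    conv_lhs => rw [← L.symm_apply_apply v]
    exact ((L.symm : E4 ≃L[ℝ] E4) : E4 →L[ℝ] E4).le_opNorm (L v)
  have h2 : ‖L v‖ ≤ ‖A - (L : E4 →L[ℝ] E4)‖ * ‖v‖ := by
    have : L v = -((A - (L : E4 →L[ℝ] E4)) v) := by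
      rw [sub_apply, hv, zero_sub, neg_neg]; rfl
    rw [this, norm_neg]
    exact (A - (L : E4 →L[ℝ] E4)).le_opNorm v
  have h3 : ‖v‖ ≤ (‖A - (L : E4 →L[ℝ] E4)‖ * ‖((L.symm : E4 ≃L[ℝ] E4) : E4 →L[ℝ] E4)‖) * ‖v‖ := by
    calc ‖v‖ ≤ ‖((L.symm : E4 ≃L[ℝ] E4) : E4 →L[ℝ] E4)‖ * ‖L v‖ := h1
      _ ≤ ‖((L.symm : E4 ≃L[ℝ] E4) : E4 →L[ℝ] E4)‖ * (‖A - (L : E4 →L[ℝ] E4)‖ * ‖v‖) :=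
          mul_le_mul_of_nonneg_left h2 (norm_nonneg _)
      _ = (‖A - (L : E4 →L[ℝ] E4)‖ * ‖((L.symm : E4 ≃L[ℝ] E4) : E4 →L[ℝ] E4)‖) * ‖v‖ := by ring
  nlinarith

section DInj

variable (Λ : ℝ → lorentzGroup) (ξ : ℝ → E3) (T₀ : ℝ → ℝ)
  (hΛ : ContDiff ℝ ∞ (fun t ↦ ((Λ t : E4 ≃L[ℝ] E4) : E4 →L[ℝ] E4)))
  (hξ : ContDiff ℝ ∞ ξ) (hT₀ : ContDiff ℝ ∞ T₀)
  (hclock : ∀ τ, HasDerivAt T₀ (frameVel (Λ (T₀ τ)) 0) τ)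
  {γ : ℝ} (hγ1 : 1 ≤ γ) (hu1 : ∀ t, 1 ≤ frameVel (Λ t) 0)
  (huγ : ∀ t, |((Λ t : E4 ≃L[ℝ] E4) (E4.basisVector 0)) 0| ≤ γ)
  {S δ : ℝ} (hδ0 : 0 ≤ δ) (hδ1 : δ ≤ 1)
  (hu' : ∀ s, S ≤ s → ‖deriv (fun t ↦ frameVel (Λ t) 0) s‖ ≤ δ)
  (hu'' : ∀ s, S ≤ s → ‖iteratedDeriv 2 (fun t ↦ frameVel (Λ t) 0) s‖ ≤ δ)
  (hL' : ∀ s, S ≤ s → ‖deriv (fun t ↦ frameTilt (Λ t)) s‖ ≤ δ)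
  (hL'' : ∀ s, S ≤ s → ‖iteratedDeriv 2 (fun t ↦ frameTilt (Λ t)) s‖ ≤ δ)
  (hL''' : ∀ s, S ≤ s → ‖iteratedDeriv 3 (fun t ↦ frameTilt (Λ t)) s‖ ≤ δ)
  (hP' : ∀ s, S ≤ s → ‖deriv (fun t ↦ purgedFrame (Λ t)) s‖ ≤ δ)
  (hP'' : ∀ s, S ≤ s → ‖iteratedDeriv 2 (fun t ↦ purgedFrame (Λ t)) s‖ ≤ δ)
  (hP''' : ∀ s, S ≤ s → ‖iteratedDeriv 3 (fun t ↦ purgedFrame (Λ t)) s‖ ≤ δ)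
  (hc' : ∀ s, S ≤ s → ‖deriv (centrePath ξ) s - normVel (Λ s)‖ ≤ δ)
  (hc'' : ∀ s, S ≤ s → ‖iteratedDeriv 2 (centrePath ξ) s‖ ≤ δ)
  (hc''' : ∀ s, S ≤ s → ‖iteratedDeriv 3 (centrePath ξ) s‖ ≤ δ)

include hΛ hξ hT₀ hclock hγ1 hu1 huγ hδ0 hδ1 hu' hu'' hL' hL'' hL''' hP' hP'' hP''' hc' hc'' hc''' in
/-- **The differential of the honest chart is injective on `Q(τ₁, R)`** as soon as
`83 γ³ (1+R)⁴ δ · 4γ < 1` (monotone clock, `S + 4γR ≤ T₀(τ₁ − 1)`). [folklore] -/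
theorem injective_fderiv_honestChart {R τ₁ : ℝ} (hR : 0 ≤ R) (hS : S + 4 * γ * R ≤ T₀ (τ₁ - 1))
    (hsmall : 83 * γ ^ 3 * (1 + R) ^ 4 * δ * (4 * γ) < 1) {y : E4} (hy0 : |y 0 - τ₁| ≤ 1)
    (hy : ‖E4.spatial y‖ ≤ R) : Injective (fderiv ℝ (honestChart Λ ξ T₀) y) := by
  have hmono : Monotone T₀ :=
    (strictMono_of_deriv_pos fun x ↦ by rw [(hclock x).deriv]; linarith [hu1 (T₀ x)]).monotone
  have h1 := norm_fderiv_honestChart_sub_frame_le Λ ξ T₀ hΛ hξ hT₀ hclock hγ1 hu1 huγ hδ0 hδ1 hu' hu'' hL'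
    hL'' hL''' hP' hP'' hP''' hc' hc'' hc''' hR hmono hS hy0 hy
  have h2 : ‖((((Λ (T₀ τ₁)) : E4 ≃L[ℝ] E4).symm : E4 ≃L[ℝ] E4) : E4 →L[ℝ] E4)‖ ≤ 4 * γ :=
    (norm_lorentz_symm_le (Λ (T₀ τ₁))).trans (by linarith [huγ (T₀ τ₁), one_le_abs_lorentz_apply_zero (Λ (T₀ τ₁))])
  refine injective_of_norm_sub_mul_lt_one ((Λ (T₀ τ₁)) : E4 ≃L[ℝ] E4) _ ?_
  calc ‖fderiv ℝ (honestChart Λ ξ T₀) y - ((Λ (T₀ τ₁) : E4 ≃L[ℝ] E4) : E4 →L[ℝ] E4)‖ *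
        ‖((((Λ (T₀ τ₁)) : E4 ≃L[ℝ] E4).symm : E4 ≃L[ℝ] E4) : E4 →L[ℝ] E4)‖
      ≤ (83 * γ ^ 3 * (1 + R) ^ 4 * δ) * (4 * γ) :=
        mul_le_mul h1 h2 (norm_nonneg _) (by positivity)
    _ < 1 := hsmall

end DInj

/-- Registered one-line form (worker carrier `rechart_injective_of_norm_sub_mul_lt_one`). [folklore] -/
theorem rechart_injective_of_norm_sub_mul_lt_one : open Literature.Geometry.Lorentzian in ∀ (L : E4 ≃L[ℝ] E4) (A : E4 →L[ℝ] E4), ‖A - (L : E4 →L[ℝ] E4)‖ * ‖((L.symm : E4 ≃L[ℝ] E4) : E4 →L[ℝ] E4)‖ < 1 → Function.Injective A := injective_of_norm_sub_mul_lt_one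

end Summit.FinalStateConjecture.FinalStateConjecture.Theorems.SublinearIsFree.Rechart

end
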